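import Literature.Probability.LatticeModels.HighDimTrivialityMomentsProofs
import Literature.Probability.LatticeModels.OnsagerSzego
import Literature.Probability.LatticeModels.OnsagerToeplitzDecay
import Literature.Probability.LatticeModels.OnsagerYangSandwich
import HarnessLib

/-!
# High-dimensional triviality of Ising scaling limits, I: Aizenman's lower inequality — discharge

Topic `Literature/Probability/LatticeModels`, namespace `Literature.Probability.LatticeModels`.
Sibling proof file of `HighDimTrivialityWick.lean` (Part J), discharging its named fact
`aizenman_nPoint_le_pairingSum`:

> for the nearest-neighbour ferromagnetic Ising model on `ℤ^d`, `d ≥ 2`, `0 ≤ β ≤ β_c(d)`, every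
> DLR state `μ ∈ 𝒢(β, 0)`, every `n ≥ 2` and all `x₁, …, x_{2n} ∈ ℤ^d`,
> `⟨σ_{x₁} ⋯ σ_{x_{2n}}⟩_μ ≤ 𝒢_n[⟨σ_· σ_·⟩_μ](x₁, …, x_{2n})`

— the lower inequality `0 ≤ 𝒢_n[S_β](x₁,…,x_{2n}) − S_β(x₁,…,x_{2n})` of the first display of
§6.3 of M. Aizenman, H. Duminil-Copin, *Marginal triviality of the scaling limits of critical 4D
Ising and `φ⁴₄` models*, Ann. of Math. (2) **194** (2021) 163–235 = arXiv:1912.07973, p. 26 of the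
arXiv version ("valid for every `n ≥ 2` and derived using the switching lemma in [Aiz82]"), i.e.
Newman's Gaussian inequality (C. M. Newman, Z. Wahrsch. verw. Gebiete **33** (1975) 75, Thm. 3) for
the infinite-volume state; restated for `d ≥ 2` in R. Panis, arXiv:2309.05797, Prop. 4.6.

## The proof (every input is a theorem of the tree)

`HighDimTrivialityMomentsProofs` proved the fact for `β < β_c(d)` (`d ≥ 2`) and for `β ≤ β_c(d)`
(`d ≥ 3`) — finite-volume switching lemma (`aizenman_nPoint_le_pairingSum_finite_holds`), free box
limits, and uniqueness of the DLR state (Lebowitz–Martin-Löf below `β_c`;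
Aizenman–Duminil-Copin–Sidoravicius 2015 at `β_c`, `d ≥ 3`) — and reduced the one remaining corner
`d = 2`, `β = β_c(2)` to the continuity of the planar magnetisation, `m*(β_c(2)) = 0`
(`aizenman_nPoint_le_pairingSum_of_planarContinuity`). That input is now a theorem: the
Onsager–Yang formula `onsager_yang` follows from Wu's decay of the Toeplitz determinants of
Onsager's symbol alone (`OnsagerSzego.onsager_yang_of_wu`: transfer matrix, Kaufman's rotation, the
Toeplitz form of the row correlations, the strong Szegő limit theorem for geometric symbols,
Kramers–Wannier duality, Lebowitz–Martin-Löf, Messager–Miracle-Solé — all proved), and Wu's decay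
is proved in `OnsagerToeplitzDecay` (`toeplitzDet_onsagerSymbol_exp_decay_holds`). The formula
gives both `β_c(2) = ½ log(1+√2)` (`criticalBeta_two_of_onsager_yang`) and `m*(β) = 0` for
`β ≤ ½ log(1+√2)` (`spontaneousMagnetization_eq_zero_of_onsager_yang_of_le`), hence
`m*(β_c(2)) = 0`, uniqueness of the planar critical Gibbs measure (Lebowitz–Martin-Löf,
`hasUniqueGibbsMeasure_of_spontaneousMagnetization_eq_zero`), and the fact. As a corollary the
smeared form `newman_evenMoment_le` of `HighDimTrivialityMoments` is discharged as well
(`newman_evenMoment_le_of_pointwise`).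

No definitions, no new named facts; two discharges.

## References

* M. Aizenman, H. Duminil-Copin, Ann. of Math. (2) 194 (2021) 163–235 (arXiv:1912.07973), §6.3,
  first display, p. 26.
* C. M. Newman, Z. Wahrsch. verw. Gebiete 33 (1975) 75–93, Thm. 3.
* M. Aizenman, Comm. Math. Phys. 86 (1982) 1–48 (the switching lemma; Prop. 12.1).
* C. N. Yang, Phys. Rev. 85 (1952) 808–816; G. Benettin, G. Gallavotti, G. Jona-Lasinio,
  A. L. Stella, Comm. Math. Phys. 30 (1973) 45–54 (`m*(β_c(2)) = 0`).
* J. L. Lebowitz, A. Martin-Löf, Comm. Math. Phys. 25 (1972) 276–282 (`m* = 0 ⇒` uniqueness).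
-/

noncomputable section

namespace Literature.Probability.LatticeModels

/-- **The Onsager–Yang formula, unconditionally** (Yang 1952; Benettin–Gallavotti–Jona-Lasinio–Stella
1973, main result): `m*(β) = (1 − sinh(2β)^{-4})^{1/8}` for `β > ½ log(1+√2)` and `m*(β) = 0` for
`0 ≤ β ≤ ½ log(1+√2)` on `ℤ²` — `OnsagerSzego.onsager_yang_of_wu` fed with the proved Wu decay
`OnsagerToeplitzDecay.toeplitzDet_onsagerSymbol_exp_decay_holds`. Recorded here as the input of the
planar corner; kept under a local name (the discharge `onsager_yang_holds` belongs with
`PlanarIsing`). [cite: BenettinGallavottiJonaLasinioStella1973, §3 (main result)] -/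
theorem onsager_yang_of_tree : onsager_yang :=
  onsager_yang_of_wu toeplitzDet_onsagerSymbol_exp_decay_holds

/-- **Continuity of the planar magnetisation at the critical point**: on `ℤ²`,
`m*(β_c(2)) = 0`, where `β_c(2) = inf {β ≥ 0 | m*(β) > 0}` is the tree's `criticalBeta 2`
(Yang 1952; Benettin–Gallavotti–Jona-Lasinio–Stella 1973, §3 c) with eq. (1.1): `m = m_O`,
`m_O(β_c) = 0`, and `β_c = inf {β | m(β) > 0}` by §1). From `onsager_yang_of_tree` through
`criticalBeta_two_of_onsager_yang` and `spontaneousMagnetization_eq_zero_of_onsager_yang_of_le`. [cite: BenettinGallavottiJonaLasinioStella1973, §3 c) with eq. (1.1)] -/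
theorem spontaneousMagnetization_two_criticalBeta_eq_zero :
    spontaneousMagnetization 2 (criticalBeta 2) = 0 := by
  have hβc : criticalBeta 2 = criticalBetaTwo := criticalBeta_two_of_onsager_yang onsager_yang_of_tree
  rw [hβc]
  exact spontaneousMagnetization_eq_zero_of_onsager_yang_of_le onsager_yang_of_tree
    criticalBetaTwo_pos.le le_rfl

/-- **Uniqueness of the planar critical Gibbs measure**: `|𝒢(β_c(2), 0)| = 1` for the
nearest-neighbour Ising model on `ℤ²` (Lebowitz–Martin-Löf 1972: `m*(β) = 0 ⇒` uniqueness, the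
tree's `hasUniqueGibbsMeasure_of_spontaneousMagnetization_eq_zero`; with `m*(β_c(2)) = 0`,
Yang 1952 / BGJS 1973). [cite: AizenmanDuminilCopinSidoraviciusCMP2015, Prop. B.1 (Appendix B)] -/
theorem hasUniqueGibbsMeasure_two_criticalBeta :
    HasUniqueGibbsMeasure (isingSpecification (zdGraph 2) (criticalBeta 2) 0) :=
  hasUniqueGibbsMeasure_of_spontaneousMagnetization_eq_zero (criticalBeta_nonneg (d := 2))
    spontaneousMagnetization_two_criticalBeta_eq_zero

/-- **Aizenman's lower inequality / Newman's Gaussian inequality, discharged** (the named fact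
`aizenman_nPoint_le_pairingSum` of `HighDimTrivialityWick`, Part J): for the nearest-neighbour
Ising model on `ℤ^d`, `d ≥ 2`, `0 ≤ β ≤ β_c(d)`, every `μ ∈ 𝒢(β, 0)`, `n ≥ 2` and
`x : Fin (2n) → ℤ^d`, `⟨σ_{x₁} ⋯ σ_{x_{2n}}⟩_μ ≤ 𝒢_n[⟨σ_· σ_·⟩_μ](x)` — the lower inequality of
the first display of Aizenman–Duminil-Copin 2021, §6.3 (p. 26 of arXiv:1912.07973), "valid for
every `n ≥ 2` and derived using the switching lemma in [Aiz82]". Proof: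
`aizenman_nPoint_le_pairingSum_of_planarContinuity` (all cases but the planar critical corner are
unconditional there) fed with `spontaneousMagnetization_two_criticalBeta_eq_zero`. [cite: AizenmanDuminilCopinAnnals2021, arXiv:1912.07973 §6.3, first display, lower inequality (p. 26)] [cite: Panis2023Triviality, Prop. 4.6] -/
theorem aizenman_nPoint_le_pairingSum_holds : aizenman_nPoint_le_pairingSum :=
  aizenman_nPoint_le_pairingSum_of_planarContinuity spontaneousMagnetization_two_criticalBeta_eq_zero

/-- **Gaussian domination of the even moments of the smeared field, discharged** (the named fact
`newman_evenMoment_le` of `HighDimTrivialityMoments`): for `d ≥ 2`, `0 ≤ β ≤ β_c(d)`,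
`μ ∈ 𝒢(β, 0)`, `L > 0`, compactly supported `f ≥ 0` and every `n`,
`⟨T_{f,L}^{2n}⟩_μ ≤ (2n)!/(2ⁿ n!) ⟨T_{f,L}²⟩_μⁿ` — the lower inequality of the first display of
Aizenman–Duminil-Copin 2021, §6.3, smeared against `∏ᵢ f(xᵢ/L) ≥ 0`
(`newman_evenMoment_le_of_pointwise`). [cite: AizenmanDuminilCopinAnnals2021, arXiv:1912.07973 §6.3, first display, lower inequality (p. 26)] -/
theorem newman_evenMoment_le_holds : newman_evenMoment_le :=
  newman_evenMoment_le_of_pointwise aizenman_nPoint_le_pairingSum_holds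

end Literature.Probability.LatticeModels

end

namespace Literature.Probability.LatticeModels

/-- **`onsager_yang` is a theorem of the tree (audit alias).** The named fact `onsager_yang`
(`PlanarIsing.lean`): crit-ising.S16 (Onsager–Yang spontaneous magnetisation; Yang, Phys. Rev.
85 (1952) 808; rigorous: Benettin–Gallavotti–Jona-Lasinio–Stella, Comm. Math. Phys. 30 (1973)
45; Abraham–Martin-Löf, Comm. Math. Phys. … — is proved, with exactly this statement, by
`onsager_yang_of_tree` (this file); this alias records the discharge under the census/audit
name `onsager_yang_holds` (librarian sweep g25, pass 5c; no new mathematics).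
[cite: BenettinGallavottiJonaLasinioStella1973, main theorem (rigorous Onsager–Yang formula)]
[cite: YangPhysRev1952] -/
theorem onsager_yang_holds :
    onsager_yang :=
  Literature.Probability.LatticeModels.onsager_yang_of_tree

end Literature.Probability.LatticeModels
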